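import Mathlib
import HarnessLib
import Summits.ResolutionOfSingularities.ResolutionOfSingularities.Theses.Valuative
import Literature.AlgebraicGeometry.Resolution.QuasiExcellentSchemes

/-!
# Sketch — crux `PatchingRel` (stmt-ResolutionOfSingularities-0642), idea `sandwiched-gluing`

First checkable statements of the line (signatures only; `FirstLemma` is a `Prop`, nothing is
proved here).  All constants are existing declarations:
`Literature.AlgebraicGeometry.Resolution.{IsResolution, IsBirational, Scheme.IsRegular,
Scheme.regularLocus, ResolutionInChar}`, Mathlib's `IsProper`, `IsSeparated`,
`LocallyOfFiniteType`, `QuasiCompact`, `IsIntegral`, `Scheme.Opens`, `π ∣_ U`, and the route decl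
`Summit.ResolutionOfSingularities.ResolutionOfSingularities.Theses.Valuative.PatchingRel`.
-/

namespace Summit.ResolutionOfSingularities.ResolutionOfSingularities.Cruxes.PatchingRel.SandwichedGluing

open CategoryTheory AlgebraicGeometry
open Literature.AlgebraicGeometry.Resolution

universe u

/-- **SAND⁺(p) — strong resolution of SANDWICHED schemes in characteristic `p`.**  A scheme `V`
is *sandwiched* if it is integral and proper-birational over a REGULAR integral separated
`k`-scheme of finite type `U` (`η : V ⟶ U`).  The statement: every sandwiched `V` has a
resolution `π : Y ⟶ V` (proper, birational, `Y` regular) which is an isomorphism over the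
regular locus of `V` — the conclusion shape of `CossartPiltant2019General` (which gives the case
`dim V ≤ 3` in every characteristic). -/
def SandwichedStrongResolution (p : ℕ) : Prop :=
  ∀ (k : Type u) [Field k] [CharP k p] (U V : Scheme.{u}) (f : U ⟶ Spec (.of k)) (η : V ⟶ U),
    IsSeparated f → LocallyOfFiniteType f → QuasiCompact f → IsIntegral U →
    Scheme.IsRegular U → IsIntegral V → IsProper η → IsBirational η →
      ∃ (Y : Scheme.{u}) (π : Y ⟶ V), IsResolution π ∧
        ∃ W : V.Opens, (W : Set V) = Scheme.regularLocus V ∧ IsIso (π ∣_ W)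

/-- **Weak form used in Step 2 only** (no isomorphism clause): sandwiched schemes have SOME
resolution.  Implied by `SandwichedStrongResolution`. -/
def SandwichedResolution (p : ℕ) : Prop :=
  ∀ (k : Type u) [Field k] [CharP k p] (U V : Scheme.{u}) (f : U ⟶ Spec (.of k)) (η : V ⟶ U),
    IsSeparated f → LocallyOfFiniteType f → QuasiCompact f → IsIntegral U →
    Scheme.IsRegular U → IsIntegral V → IsProper η → IsBirational η →
      ∃ (Y : Scheme.{u}) (π : Y ⟶ V), IsResolution π

/-- **First lemma of the line (signature).**  Zariski's programme with PROPER models, gluing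
along the closure of the singular locus of the sandwiched piece `η⁻¹(Reg X₁)` and Nagata
compactification: strong resolution of sandwiched schemes in characteristic `p` (for all `p`)
implies the crux `PatchingRel` (LUrel_p → ResolutionInChar p for every prime `p`).  The
hypothesis is used at universe `0`, like the summit. -/
def FirstLemma : Prop :=
  (∀ p : ℕ, p.Prime → SandwichedStrongResolution.{0} p) →
    Summit.ResolutionOfSingularities.ResolutionOfSingularities.Theses.Valuative.PatchingRel

/-- The same cut one level down (the form a skeleton would register): for a fixed prime `p`,
SAND⁺(p) and relative local uniformization in characteristic `p` give `ResolutionInChar p`. -/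
def FirstLemmaInChar (p : ℕ) : Prop :=
  SandwichedStrongResolution.{0} p →
    (∀ (k K : Type) [Field k] [CharP k p] [Field K] [Algebra k K],
      (⊤ : IntermediateField k K).FG → ∀ O : ValuationSubring K, (∀ c : k, algebraMap k K c ∈ O) →
      ∀ R : Subalgebra k K, R.FG → R.toSubring ≤ O.toSubring →
        ∃ (A : Subalgebra k K) (h : A.toSubring ≤ O.toSubring), R ≤ A ∧ A.FG ∧
          IsFractionRing A K ∧ IsRegularLocalRing (Localization.AtPrime
            (Ideal.comap (Subring.inclusion h) (IsLocalRing.maximalIdeal O)))) →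
    ResolutionInChar.{0} p

/-- Sanity: the two cuts compose to the crux by pure logic (PatchingRel is literally
`∀ p, p.Prime → LUrel_p → ResolutionInChar p`). -/
theorem firstLemma_of_inChar (h : ∀ p : ℕ, p.Prime → FirstLemmaInChar p) : FirstLemma :=
  fun hS p hp hLU => h p hp (hS p hp) hLU

/-- Sanity: SAND⁺ implies the weak form. -/
theorem sandwichedResolution_of_strong {p : ℕ} (h : SandwichedStrongResolution.{u} p) :
    SandwichedResolution.{u} p := by
  intro k _ _ U V f η h1 h2 h3 h4 h5 h6 h7 h8
  obtain ⟨Y, π, hπ, -⟩ := h k U V f η h1 h2 h3 h4 h5 h6 h7 h8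
  exact ⟨Y, π, hπ⟩

end Summit.ResolutionOfSingularities.ResolutionOfSingularities.Cruxes.PatchingRel.SandwichedGluing
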